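import Summits.Parity.GeneralizedHardyLittlewood.Theses.RealCharacterThetaLadder
import Literature.NumberTheory.LFunctions.NoRealZeroSmallModuliIII
import Literature.NumberTheory.LFunctions.NoRealZeroEvenSmallModuliVI
import Literature.NumberTheory.LFunctions.NoRealZeroSmallModuliVI
import Literature.NumberTheory.LFunctions.NoRealZeroTruncationBase
import Literature.NumberTheory.LFunctions.NoRealZeroTruncationBaseIII
import Literature.NumberTheory.LFunctions.NoRealZeroUpToPositivity
import Literature.NumberTheory.LFunctions.ClassGroupLFunctionNoExceptionalZeroUpTo
import Literature.NumberTheory.LFunctions.IllusoryHypothesesExcludedUpTo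

/-!
# Route `RealCharacterThetaLadder`, item `PlattRange` — what the KERNEL wide base (`q ≤ 231`, both
# parities; even `q ≤ 292`) gives the consumers, unconditionally

Cell `parity-realchar` (summit Parity, column REALCHAR), kernel side; `TARGET.md §4 P4` / `CONSUMERS.md`
§P3, §W1, §W2, §C4′. The support item `PlattRange` (= `NoRealZeroUpTo 400000`, Platt's printed range)
is closed in the route's own currency by certified numerics; its KERNEL sub-range — no named fact, no
numerics of record, standard axioms — is, after `NoRealZeroSmallModuliIII.lean` (cell seats sweep-4 /
prover, 2026-08-26: Fekete–Pólya positivity along Chowla-induced characters + Epstein class sums),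
`noRealZeroUpTo_231 : NoRealZeroUpTo 231` (both parities; contains Rosser's 1950 range `q ≤ 227`) and
`noRealZeroEvenUpTo_292`. This file records the by-name consumers of that base, i.e. the widest
HYPOTHESIS-FREE "wide" statements of the tree:

* `kernelWide_plattRange_restrict` — `PlattRange` restricted to `q ≤ 231` holds outright;
* `kernelWide_lfunction_re_pos` / `kernelWide_centralValue_pos` (W1) — `L(σ, χ) > 0` for every real
  `σ > 0`, in particular `L(1/2, χ) > 0`, for every quadratic `χ ≠ χ₀` (primitive or not) mod `q ≤ 231`;
  `kernelWide_even_centralValue_pos` — the same for primitive EVEN `χ`, `3 ≤ q ≤ 292`;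
* `kernelWide_dedekindZeta_quadratic_ne_zero` (W2) — `ζ_k(σ) ≠ 0` on `(0, 1)` for every quadratic
  field `k` with `|d_k| ≤ 231`;
* `kernelWide_dedekindZeta_starkWindow_of_quadraticSubfields` (C4′, wide) — for every number field `K`
  of degree `n > 1` all of whose quadratic subfields have `|d_k| ≤ 231`, `ζ_K(σ) ≠ 0` on Stark's whole
  window `[1 − 1/(4·n!·log|d_K|), 1)`; `kernelWide_classGroupLFunction_ne_zero` (C4) — real class group
  `L`-functions of fields with `|d_K| ≤ 231`;
* `kernelWide_not_isSiegelZero` — no Siegel zero of any quality at conductors `3 ≤ q ≤ 231` (the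
  narrow criterion `NoExceptionalZeroUpTo 231 c`, every `c`, is `noExceptionalZeroUpTo_231` of the base file).

WHAT THIS IS NOT: nothing beyond `231` (resp. `292` even); the unconditional NARROW leaf to `4·10⁵`
(`noExceptionalZeroUpTo_4e5_fifth`, route `LZZCertificateReplay`) and its consumers
(`LZZCertificateReplayKernelConsumers.lean`) are the wider-range statements near `σ = 1`; here the
whole interval `(0, 1)` is covered, for small conductors. No Parity credit (cell rule H5).
-/

noncomputable section

namespace Summit.Parity.GeneralizedHardyLittlewood.Theorems

open Literature.NumberTheory.LFunctions Literature.NumberTheory.LFunctions.NumberField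
  Literature.NumberTheory.QuadraticFields Literature.Barriers.Parity

/-- **`PlattRange` restricted to `q ≤ 231` holds in the kernel**: for every modulus `3 ≤ q ≤ 231`, every
primitive quadratic `χ` mod `q` and every `σ ∈ (0, 1)`, `L(σ, χ) ≠ 0` — unconditionally (the item
`PlattRange` itself is `NoRealZeroUpTo 400000`). -/
theorem kernelWide_plattRange_restrict :
    ∀ (q : ℕ) [NeZero q], 3 ≤ q → q ≤ 231 → ∀ χ : DirichletCharacter ℂ q, χ.IsQuadratic →
      χ.IsPrimitive → ∀ σ : ℝ, 0 < σ → σ < 1 → χ.LFunction σ ≠ 0 :=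
  noRealZeroUpTo_231

/-- The item `PlattRange` implies the kernel base (trivially, by restriction) — recorded so that the
item's closing currency and the kernel sub-range are comparable by name. -/
theorem kernelWide_of_plattRange (h : Theses.RealCharacterThetaLadder.PlattRange) : NoRealZeroUpTo 231 :=
  NoRealZeroUpTo.anti_level h (by norm_num)

/-- **Positivity on `(0, ∞)`, UNCONDITIONAL, `q ≤ 231`**: for every quadratic `χ ≠ χ₀` mod `q ≤ 231`
(primitive or not) and every real `σ > 0`, `Re L(σ, χ) > 0`. -/
theorem kernelWide_lfunction_re_pos {q : ℕ} [NeZero q] (hqQ : q ≤ 231) (χ : DirichletCharacter ℂ q)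
    (hquad : χ.IsQuadratic) (hχ : χ ≠ 1) {σ : ℝ} (hσ : 0 < σ) : 0 < (χ.LFunction σ).re :=
  noRealZeroUpTo_231.lfunction_re_pos hqQ χ hquad hχ hσ

/-- **Central values, UNCONDITIONAL (consumer W1), `q ≤ 231`**: `L(1/2, χ) > 0` for every quadratic
`χ ≠ χ₀` mod `q ≤ 231`. -/
theorem kernelWide_centralValue_pos {q : ℕ} [NeZero q] (hqQ : q ≤ 231) (χ : DirichletCharacter ℂ q)
    (hquad : χ.IsQuadratic) (hχ : χ ≠ 1) : 0 < (χ.LFunction (1 / 2 : ℝ)).re :=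
  noRealZeroUpTo_231.lfunction_one_half_pos hqQ χ hquad hχ

/-- **Central values of EVEN characters, UNCONDITIONAL, `3 ≤ q ≤ 292`**: `L(1/2, χ) > 0` for every
primitive quadratic even `χ` mod `q` (real quadratic fields of discriminant `≤ 292`). -/
theorem kernelWide_even_centralValue_pos {q : ℕ} [NeZero q] (hq3 : 3 ≤ q) (hqQ : q ≤ 292)
    (χ : DirichletCharacter ℂ q) (hquad : χ.IsQuadratic) (hprim : χ.IsPrimitive) (hev : χ.Even) :
    0 < (χ.LFunction (1 / 2 : ℝ)).re :=
  noRealZeroEvenUpTo_292.lfunction_one_half_pos hq3 hqQ χ hquad hprim hev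

/-- **No real zero of a quadratic Dedekind zeta function in `(0, 1)`, UNCONDITIONAL (consumer W2),
`|d_k| ≤ 231`**: for every quadratic number field `k` with `|d_k| ≤ 231` and every `σ ∈ (0, 1)`,
`ζ_k(σ) ≠ 0` (`ζ_k = ζ·L(·, χ_{d_k})`; a zero would be a zero of the primitive character `χ_{d_k}`). -/
theorem kernelWide_dedekindZeta_quadratic_ne_zero (k : Type) [Field k] [NumberField k]
    (h2 : Module.finrank ℚ k = 2) (hkQ : (NumberField.discr k).natAbs ≤ 231) {σ : ℝ} (hσ0 : 0 < σ)
    (hσ1 : σ < 1) : Literature.NumberTheory.LFunctions.dedekindZetaCont k σ ≠ 0 := by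
  intro h0
  obtain ⟨M, _, κ, hM, hM3, -, hsq, hprim, hLz⟩ :=
    Quadratic.exists_primitive_LFunction_eq_zero_of_realZero h2 hσ0 hσ1 h0
  subst hM
  exact noRealZeroUpTo_231 _ hM3 hkQ κ (MulChar.isQuadratic_iff_sq_eq_one.mpr hsq) hprim σ hσ0 hσ1 hLz

/-- **Stark's whole window is zero-free for every number field whose quadratic subfields have
`|d_k| ≤ 231`, UNCONDITIONAL (consumer C4′, wide form)**: for `K` of degree `n > 1` all of whose
quadratic subfields `k` have `|d_k| ≤ 231` (vacuous if there are none) and `1 − 1/(4·n!·log|d_K|) ≤ σ < 1`: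
`ζ_K(σ) ≠ 0`. -/
theorem kernelWide_dedekindZeta_starkWindow_of_quadraticSubfields (K : Type) [Field K] [NumberField K]
    (hK : 1 < Module.finrank ℚ K)
    (hQ : ∀ k : IntermediateField ℚ K, Module.finrank ℚ k = 2 → (NumberField.discr k).natAbs ≤ 231)
    {σ : ℝ} (hσ : 1 - 1 / (4 * ((Module.finrank ℚ K).factorial : ℝ) *
      Real.log ((NumberField.discr K).natAbs : ℝ)) ≤ σ) (hσ1 : σ < 1) :
    Literature.NumberTheory.LFunctions.dedekindZetaCont K σ ≠ 0 :=
  dedekindZetaCont_ne_zero_of_noRealZeroUpTo_of_quadraticSubfields noRealZeroUpTo_231 K hK hQ hσ hσ1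

/-- **Real class group `L`-functions of fields with `|d_K| ≤ 231`, UNCONDITIONAL (consumer C4)**: for
`K` of degree `n > 1` with `|d_K| ≤ 231`, every class group character `χ` with `χ² = 1` (`ζ_K` included)
and `1 − 1/(8·(2n)!·log|d_K|) ≤ σ < 1`: `L(σ, χ) ≠ 0`. -/
theorem kernelWide_classGroupLFunction_ne_zero (K : Type) [Field K] [NumberField K]
    (hK : 1 < Module.finrank ℚ K) (hdQ : (NumberField.discr K).natAbs ≤ 231)
    (χ : ClassGroup (NumberField.RingOfIntegers K) →* ℂˣ) (hχ : χ * χ = 1) {σ : ℝ}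
    (hσ : 1 - 1 / (8 * ((2 * Module.finrank ℚ K).factorial : ℝ) *
      Real.log ((NumberField.discr K).natAbs : ℝ)) ≤ σ) (hσ1 : σ < 1) :
    classGroupLFunction K χ σ ≠ 0 :=
  classGroupLFunction_ne_zero_of_noRealZeroUpTo noRealZeroUpTo_231 K hK hdQ χ hχ hσ hσ1

/-- **No Siegel zero of any quality at conductors `3 ≤ q ≤ 231`, UNCONDITIONAL**: for every `χ` mod `q`
and every `η`, `¬ IsSiegelZero χ η`. -/
theorem kernelWide_not_isSiegelZero {q : ℕ} [NeZero q] (hq3 : 3 ≤ q) (hqQ : q ≤ 231)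
    (χ : DirichletCharacter ℂ q) (η : ℝ) : ¬ IsSiegelZero χ η :=
  not_isSiegelZero_of_noRealZeroUpTo noRealZeroUpTo_231 hq3 hqQ χ η

/-! ## Appendix (append-only, 2026-08-27): the even kernel base raised to `436` -/

/-- **Central values of EVEN characters, UNCONDITIONAL, `3 ≤ q ≤ 436`**: `L(1/2, χ) > 0` for every
primitive quadratic even `χ` mod `q ≤ 436` (real quadratic fields of discriminant `≤ 436`; kernel base
`noRealZeroEvenUpTo_436`: Fekete–Pólya of order `≤ 12` along induced characters, `χ₂₉₃` at order `8`
and induced modulus `293·1001`). -/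
theorem kernelWide_even_centralValue_pos_436 {q : ℕ} [NeZero q] (hq3 : 3 ≤ q) (hqQ : q ≤ 436)
    (χ : DirichletCharacter ℂ q) (hquad : χ.IsQuadratic) (hprim : χ.IsPrimitive) (hev : χ.Even) :
    0 < (χ.LFunction (1 / 2 : ℝ)).re :=
  noRealZeroEvenUpTo_436.lfunction_one_half_pos hq3 hqQ χ hquad hprim hev

/-- **No real zero in `(0, 1)` for EVEN quadratic characters of modulus `≤ 436`, UNCONDITIONAL**
(imprimitive included): for every quadratic even `χ ≠ χ₀` mod `q ≤ 436` and every `σ ∈ (0, 1)`,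
`L(σ, χ) ≠ 0`. -/
theorem kernelWide_even_lfunction_ne_zero_436 {q : ℕ} [NeZero q] (hqQ : q ≤ 436)
    (χ : DirichletCharacter ℂ q) (hquad : χ.IsQuadratic) (hχ : χ ≠ 1) (hev : χ.Even) {σ : ℝ}
    (hσ0 : 0 < σ) (hσ1 : σ < 1) : χ.LFunction σ ≠ 0 :=
  noRealZeroEvenUpTo_436.lfunction_ne_zero hqQ χ hquad hχ hev hσ0 hσ1

/-! ## Appendix II (append-only, 2026-08-27): BOTH parities raised to `436` by Low's Epstein grouping

`noRealZeroUpTo_436` (`NoRealZeroSmallModuliVI.lean`, cell seat prover g7): the odd side passes the former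
walls `232, 235, 267, 340, 372, 379, 388, 403, 408, 427` (no order-two Fekete–Pólya certificate) by
grouping the principal Epstein zeta function of the class group with a partner class
(`Literature/Barriers/RiemannHypothesis/EpsteinZetaRealZerosPairGrouping*.lean`); the remaining odd
conductors by order-two certificates along induced characters. The consumers of the first section,
verbatim at level `436`. -/

/-- **`PlattRange` restricted to `q ≤ 436` holds in the kernel**, both parities. -/
theorem kernelWide_plattRange_restrict_436 :
    ∀ (q : ℕ) [NeZero q], 3 ≤ q → q ≤ 436 →
      ∀ χ : DirichletCharacter ℂ q, χ.IsQuadratic → χ.IsPrimitive →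
        ∀ σ : ℝ, 0 < σ → σ < 1 → χ.LFunction σ ≠ 0 :=
  noRealZeroUpTo_436

/-- **Positivity on `(0, ∞)`, UNCONDITIONAL, `q ≤ 436`**: for every quadratic `χ ≠ χ₀` mod `q ≤ 436`
(primitive or not) and every real `σ > 0`, `Re L(σ, χ) > 0`. -/
theorem kernelWide_lfunction_re_pos_436 {q : ℕ} [NeZero q] (hqQ : q ≤ 436) (χ : DirichletCharacter ℂ q)
    (hquad : χ.IsQuadratic) (hχ : χ ≠ 1) {σ : ℝ} (hσ : 0 < σ) : 0 < (χ.LFunction σ).re :=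
  noRealZeroUpTo_436.lfunction_re_pos hqQ χ hquad hχ hσ

/-- **Central values, UNCONDITIONAL (consumer W1), `q ≤ 436`**: `L(1/2, χ) > 0` for every quadratic
`χ ≠ χ₀` mod `q ≤ 436`. -/
theorem kernelWide_centralValue_pos_436 {q : ℕ} [NeZero q] (hqQ : q ≤ 436) (χ : DirichletCharacter ℂ q)
    (hquad : χ.IsQuadratic) (hχ : χ ≠ 1) : 0 < (χ.LFunction (1 / 2 : ℝ)).re :=
  noRealZeroUpTo_436.lfunction_one_half_pos hqQ χ hquad hχ

/-- **No real zero of a quadratic Dedekind zeta function in `(0, 1)`, UNCONDITIONAL (consumer W2),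
`|d_k| ≤ 436`**: for every quadratic number field `k` with `|d_k| ≤ 436` and every `σ ∈ (0, 1)`,
`ζ_k(σ) ≠ 0`. -/
theorem kernelWide_dedekindZeta_quadratic_ne_zero_436 (k : Type) [Field k] [NumberField k]
    (h2 : Module.finrank ℚ k = 2) (hkQ : (NumberField.discr k).natAbs ≤ 436) {σ : ℝ} (hσ0 : 0 < σ)
    (hσ1 : σ < 1) : Literature.NumberTheory.LFunctions.dedekindZetaCont k σ ≠ 0 := by
  intro h0
  obtain ⟨M, _, κ, hM, hM3, -, hsq, hprim, hLz⟩ :=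
    Quadratic.exists_primitive_LFunction_eq_zero_of_realZero h2 hσ0 hσ1 h0
  subst hM
  exact noRealZeroUpTo_436 _ hM3 hkQ κ (MulChar.isQuadratic_iff_sq_eq_one.mpr hsq) hprim σ hσ0 hσ1 hLz

/-- **Stark's whole window is zero-free for every number field whose quadratic subfields have
`|d_k| ≤ 436`, UNCONDITIONAL (consumer C4′, wide form)**. -/
theorem kernelWide_dedekindZeta_starkWindow_of_quadraticSubfields_436 (K : Type) [Field K]
    [NumberField K] (hK : 1 < Module.finrank ℚ K)
    (hQ : ∀ k : IntermediateField ℚ K, Module.finrank ℚ k = 2 → (NumberField.discr k).natAbs ≤ 436)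
    {σ : ℝ} (hσ : 1 - 1 / (4 * ((Module.finrank ℚ K).factorial : ℝ) *
      Real.log ((NumberField.discr K).natAbs : ℝ)) ≤ σ) (hσ1 : σ < 1) :
    Literature.NumberTheory.LFunctions.dedekindZetaCont K σ ≠ 0 :=
  dedekindZetaCont_ne_zero_of_noRealZeroUpTo_of_quadraticSubfields noRealZeroUpTo_436 K hK hQ hσ hσ1

/-- **Real class group `L`-functions of fields with `|d_K| ≤ 436`, UNCONDITIONAL (consumer C4)**. -/
theorem kernelWide_classGroupLFunction_ne_zero_436 (K : Type) [Field K] [NumberField K]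
    (hK : 1 < Module.finrank ℚ K) (hdQ : (NumberField.discr K).natAbs ≤ 436)
    (χ : ClassGroup (NumberField.RingOfIntegers K) →* ℂˣ) (hχ : χ * χ = 1) {σ : ℝ}
    (hσ : 1 - 1 / (8 * ((2 * Module.finrank ℚ K).factorial : ℝ) *
      Real.log ((NumberField.discr K).natAbs : ℝ)) ≤ σ) (hσ1 : σ < 1) :
    classGroupLFunction K χ σ ≠ 0 :=
  classGroupLFunction_ne_zero_of_noRealZeroUpTo noRealZeroUpTo_436 K hK hdQ χ hχ hσ hσ1

/-- **No Siegel zero of any quality at conductors `3 ≤ q ≤ 436`, UNCONDITIONAL**: for every `χ` mod `q`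
and every `η`, `¬ IsSiegelZero χ η`. -/
theorem kernelWide_not_isSiegelZero_436 {q : ℕ} [NeZero q] (hq3 : 3 ≤ q) (hqQ : q ≤ 436)
    (χ : DirichletCharacter ℂ q) (η : ℝ) : ¬ IsSiegelZero χ η :=
  not_isSiegelZero_of_noRealZeroUpTo noRealZeroUpTo_436 hq3 hqQ χ η

/-! ## Appendix III (append-only, 2026-08-27): BOTH parities raised to `1100` by the Davenport–Chua
truncation certificates

`noRealZeroUpTo_1100` (`NoRealZeroTruncationBase.lean`, cell seat prover g8): the even wall `χ₄₃₇` and every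
conductor up to `1100` of either parity by one-period truncations of the Dirichlet series with a second-order
tail bound (`DirichletLTruncationBound.lean`, `DirichletLTruncationCertificates*.lean`), the odd conductors
`708, 760, 1012` by the mean (class-number drift) form of the certificate. The consumers of the first section,
verbatim at level `1100`. -/

/-- **`PlattRange` restricted to `q ≤ 1100` holds in the kernel**, both parities. -/
theorem kernelWide_plattRange_restrict_1100 :
    ∀ (q : ℕ) [NeZero q], 3 ≤ q → q ≤ 1100 →
      ∀ χ : DirichletCharacter ℂ q, χ.IsQuadratic → χ.IsPrimitive →
        ∀ σ : ℝ, 0 < σ → σ < 1 → χ.LFunction σ ≠ 0 :=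
  noRealZeroUpTo_1100

/-- **Positivity on `(0, ∞)`, UNCONDITIONAL, `q ≤ 1100`**: for every quadratic `χ ≠ χ₀` mod `q ≤ 1100`
(primitive or not) and every real `σ > 0`, `Re L(σ, χ) > 0`. -/
theorem kernelWide_lfunction_re_pos_1100 {q : ℕ} [NeZero q] (hqQ : q ≤ 1100) (χ : DirichletCharacter ℂ q)
    (hquad : χ.IsQuadratic) (hχ : χ ≠ 1) {σ : ℝ} (hσ : 0 < σ) : 0 < (χ.LFunction σ).re :=
  noRealZeroUpTo_1100.lfunction_re_pos hqQ χ hquad hχ hσ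

/-- **Central values, UNCONDITIONAL (consumer W1), `q ≤ 1100`**: `L(1/2, χ) > 0` for every quadratic
`χ ≠ χ₀` mod `q ≤ 1100`. -/
theorem kernelWide_centralValue_pos_1100 {q : ℕ} [NeZero q] (hqQ : q ≤ 1100) (χ : DirichletCharacter ℂ q)
    (hquad : χ.IsQuadratic) (hχ : χ ≠ 1) : 0 < (χ.LFunction (1 / 2 : ℝ)).re :=
  noRealZeroUpTo_1100.lfunction_one_half_pos hqQ χ hquad hχ

/-- **No real zero of a quadratic Dedekind zeta function in `(0, 1)`, UNCONDITIONAL (consumer W2),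
`|d_k| ≤ 1100`**: for every quadratic number field `k` with `|d_k| ≤ 1100` and every `σ ∈ (0, 1)`,
`ζ_k(σ) ≠ 0`. -/
theorem kernelWide_dedekindZeta_quadratic_ne_zero_1100 (k : Type) [Field k] [NumberField k]
    (h2 : Module.finrank ℚ k = 2) (hkQ : (NumberField.discr k).natAbs ≤ 1100) {σ : ℝ} (hσ0 : 0 < σ)
    (hσ1 : σ < 1) : Literature.NumberTheory.LFunctions.dedekindZetaCont k σ ≠ 0 := by
  intro h0
  obtain ⟨M, _, κ, hM, hM3, -, hsq, hprim, hLz⟩ :=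
    Quadratic.exists_primitive_LFunction_eq_zero_of_realZero h2 hσ0 hσ1 h0
  subst hM
  exact noRealZeroUpTo_1100 _ hM3 hkQ κ (MulChar.isQuadratic_iff_sq_eq_one.mpr hsq) hprim σ hσ0 hσ1 hLz

/-- **Stark's whole window is zero-free for every number field whose quadratic subfields have
`|d_k| ≤ 1100`, UNCONDITIONAL (consumer C4′, wide form)**. -/
theorem kernelWide_dedekindZeta_starkWindow_of_quadraticSubfields_1100 (K : Type) [Field K]
    [NumberField K] (hK : 1 < Module.finrank ℚ K)
    (hQ : ∀ k : IntermediateField ℚ K, Module.finrank ℚ k = 2 → (NumberField.discr k).natAbs ≤ 1100)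
    {σ : ℝ} (hσ : 1 - 1 / (4 * ((Module.finrank ℚ K).factorial : ℝ) *
      Real.log ((NumberField.discr K).natAbs : ℝ)) ≤ σ) (hσ1 : σ < 1) :
    Literature.NumberTheory.LFunctions.dedekindZetaCont K σ ≠ 0 :=
  dedekindZetaCont_ne_zero_of_noRealZeroUpTo_of_quadraticSubfields noRealZeroUpTo_1100 K hK hQ hσ hσ1

/-- **Real class group `L`-functions of fields with `|d_K| ≤ 1100`, UNCONDITIONAL (consumer C4)**. -/
theorem kernelWide_classGroupLFunction_ne_zero_1100 (K : Type) [Field K] [NumberField K]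
    (hK : 1 < Module.finrank ℚ K) (hdQ : (NumberField.discr K).natAbs ≤ 1100)
    (χ : ClassGroup (NumberField.RingOfIntegers K) →* ℂˣ) (hχ : χ * χ = 1) {σ : ℝ}
    (hσ : 1 - 1 / (8 * ((2 * Module.finrank ℚ K).factorial : ℝ) *
      Real.log ((NumberField.discr K).natAbs : ℝ)) ≤ σ) (hσ1 : σ < 1) :
    classGroupLFunction K χ σ ≠ 0 :=
  classGroupLFunction_ne_zero_of_noRealZeroUpTo noRealZeroUpTo_1100 K hK hdQ χ hχ hσ hσ1

/-- **No Siegel zero of any quality at conductors `3 ≤ q ≤ 1100`, UNCONDITIONAL**: for every `χ` mod `q`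
and every `η`, `¬ IsSiegelZero χ η`. -/
theorem kernelWide_not_isSiegelZero_1100 {q : ℕ} [NeZero q] (hq3 : 3 ≤ q) (hqQ : q ≤ 1100)
    (χ : DirichletCharacter ℂ q) (η : ℝ) : ¬ IsSiegelZero χ η :=
  not_isSiegelZero_of_noRealZeroUpTo noRealZeroUpTo_1100 hq3 hqQ χ η

/-! ## Appendix IV (append-only, 2026-08-27): BOTH parities raised to `2000` (truncation certificates, blocks
`1101 … 2000`, the conductors `1411` and `1592` by segmented kernel evaluation)

`noRealZeroUpTo_2000` (`NoRealZeroTruncationBaseIII.lean`, cell seat prover g8). The consumers of the first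
section, verbatim at level `2000`. -/

/-- **`PlattRange` restricted to `q ≤ 2000` holds in the kernel**, both parities. -/
theorem kernelWide_plattRange_restrict_2000 :
    ∀ (q : ℕ) [NeZero q], 3 ≤ q → q ≤ 2000 →
      ∀ χ : DirichletCharacter ℂ q, χ.IsQuadratic → χ.IsPrimitive →
        ∀ σ : ℝ, 0 < σ → σ < 1 → χ.LFunction σ ≠ 0 :=
  noRealZeroUpTo_2000

/-- **Positivity on `(0, ∞)`, UNCONDITIONAL, `q ≤ 2000`**: for every quadratic `χ ≠ χ₀` mod `q ≤ 2000`
(primitive or not) and every real `σ > 0`, `Re L(σ, χ) > 0`. -/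
theorem kernelWide_lfunction_re_pos_2000 {q : ℕ} [NeZero q] (hqQ : q ≤ 2000) (χ : DirichletCharacter ℂ q)
    (hquad : χ.IsQuadratic) (hχ : χ ≠ 1) {σ : ℝ} (hσ : 0 < σ) : 0 < (χ.LFunction σ).re :=
  noRealZeroUpTo_2000.lfunction_re_pos hqQ χ hquad hχ hσ

/-- **Central values, UNCONDITIONAL (consumer W1), `q ≤ 2000`**: `L(1/2, χ) > 0` for every quadratic
`χ ≠ χ₀` mod `q ≤ 2000`. -/
theorem kernelWide_centralValue_pos_2000 {q : ℕ} [NeZero q] (hqQ : q ≤ 2000) (χ : DirichletCharacter ℂ q)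
    (hquad : χ.IsQuadratic) (hχ : χ ≠ 1) : 0 < (χ.LFunction (1 / 2 : ℝ)).re :=
  noRealZeroUpTo_2000.lfunction_one_half_pos hqQ χ hquad hχ

/-- **No real zero of a quadratic Dedekind zeta function in `(0, 1)`, UNCONDITIONAL (consumer W2),
`|d_k| ≤ 2000`**. -/
theorem kernelWide_dedekindZeta_quadratic_ne_zero_2000 (k : Type) [Field k] [NumberField k]
    (h2 : Module.finrank ℚ k = 2) (hkQ : (NumberField.discr k).natAbs ≤ 2000) {σ : ℝ} (hσ0 : 0 < σ)
    (hσ1 : σ < 1) : Literature.NumberTheory.LFunctions.dedekindZetaCont k σ ≠ 0 := by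
  intro h0
  obtain ⟨M, _, κ, hM, hM3, -, hsq, hprim, hLz⟩ :=
    Quadratic.exists_primitive_LFunction_eq_zero_of_realZero h2 hσ0 hσ1 h0
  subst hM
  exact noRealZeroUpTo_2000 _ hM3 hkQ κ (MulChar.isQuadratic_iff_sq_eq_one.mpr hsq) hprim σ hσ0 hσ1 hLz

/-- **Stark's whole window is zero-free for every number field whose quadratic subfields have
`|d_k| ≤ 2000`, UNCONDITIONAL (consumer C4′, wide form)**. -/
theorem kernelWide_dedekindZeta_starkWindow_of_quadraticSubfields_2000 (K : Type) [Field K]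
    [NumberField K] (hK : 1 < Module.finrank ℚ K)
    (hQ : ∀ k : IntermediateField ℚ K, Module.finrank ℚ k = 2 → (NumberField.discr k).natAbs ≤ 2000)
    {σ : ℝ} (hσ : 1 - 1 / (4 * ((Module.finrank ℚ K).factorial : ℝ) *
      Real.log ((NumberField.discr K).natAbs : ℝ)) ≤ σ) (hσ1 : σ < 1) :
    Literature.NumberTheory.LFunctions.dedekindZetaCont K σ ≠ 0 :=
  dedekindZetaCont_ne_zero_of_noRealZeroUpTo_of_quadraticSubfields noRealZeroUpTo_2000 K hK hQ hσ hσ1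

/-- **Real class group `L`-functions of fields with `|d_K| ≤ 2000`, UNCONDITIONAL (consumer C4)**. -/
theorem kernelWide_classGroupLFunction_ne_zero_2000 (K : Type) [Field K] [NumberField K]
    (hK : 1 < Module.finrank ℚ K) (hdQ : (NumberField.discr K).natAbs ≤ 2000)
    (χ : ClassGroup (NumberField.RingOfIntegers K) →* ℂˣ) (hχ : χ * χ = 1) {σ : ℝ}
    (hσ : 1 - 1 / (8 * ((2 * Module.finrank ℚ K).factorial : ℝ) *
      Real.log ((NumberField.discr K).natAbs : ℝ)) ≤ σ) (hσ1 : σ < 1) :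
    classGroupLFunction K χ σ ≠ 0 :=
  classGroupLFunction_ne_zero_of_noRealZeroUpTo noRealZeroUpTo_2000 K hK hdQ χ hχ hσ hσ1

/-- **No Siegel zero of any quality at conductors `3 ≤ q ≤ 2000`, UNCONDITIONAL**. -/
theorem kernelWide_not_isSiegelZero_2000 {q : ℕ} [NeZero q] (hq3 : 3 ≤ q) (hqQ : q ≤ 2000)
    (χ : DirichletCharacter ℂ q) (η : ℝ) : ¬ IsSiegelZero χ η :=
  not_isSiegelZero_of_noRealZeroUpTo noRealZeroUpTo_2000 hq3 hqQ χ η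

end Summit.Parity.GeneralizedHardyLittlewood.Theorems

end
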